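import Literature.NumberTheory.LFunctions.RudnickSarnakSieving
import Literature.NumberTheory.LFunctions.RudnickSarnakPullback
import HarnessLib

/-!
# Rudnick–Sarnak §4 for `ζ`: reduction of the sieving step to Theorem 4.1

Z. Rudnick, P. Sarnak, *Zeros of principal `L`-functions and random matrix theory*, Duke Math.
J. **81** (1996), §4. The named fact `rudnick_sarnak_sieving` (`RudnickSarnak.lean`:
`RH → RSUnrestrictedLimits → RSRestrictedLimits`, i.e. "Theorem 3.2 at every level implies the
`T`-indexed Theorem 1.2") packages three printed steps:

1. the Möbius sieving `R_O = ∑_F μ(O, F) C_F` over the lattice `Π_n` of set partitions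
   ((4.5)–(4.9)) — PROVED, `RudnickSarnakSieving.lean`;
2. `C_F(f_Φ, T) = C_ν(ι_F^* f_Φ, T)` with `ι_F^* f_Φ = f_{Φ_F}` again admissible at level `ν(F)`
   ((4.6), (4.14)), so that Theorem 3.2 applies to it — PROVED in the form "there is an
   admissible `Φ'` with `f_{Φ'} = ι_F^* f_Φ`", `RudnickSarnakPullback.lean`;
3. the identification of the resulting limit `∑_F μ(O, F) ∫ Φ C_F` ((4.15)–(4.16), Lemma 4.1)
   with the GUE answer `∫ f_Φ(x) W_n(x) δ(x̄) dx`: **Theorem 4.1** ("for `∑ |u_j| < 2`, the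
   Fourier transform `Ŵ_n(u)` is equal to `R_O(u) = ∑_F μ(O, F) C_F(u)`", Props. 4.1–4.3,
   pp. 307–316) together with Parseval — recorded below as the named fact
   `rudnick_sarnak_thm41`, and NOT proved here.

`rudnick_sarnak_sieving_of_thm41` proves `rudnick_sarnak_sieving` from `rudnick_sarnak_thm41`
alone, so that after this file the trust base of `Literature.NumberTheory.LFunctions.rudnick_sarnak`
(via `rudnick_sarnak_of_sieving`, `RudnickSarnakProofs.lean`) is
`{rudnick_sarnak_unrestricted (RS Thm. 3.2), rudnick_sarnak_thm41 (RS Thm. 4.1 + (4.13)–(4.16))}`.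

## The form of the Theorem 4.1 fact

RS pair the distribution `R_O(u) = ∑_F μ(O, F) C_F(u)` ((4.16)) with `Φ`; by Lemma 4.1 / (4.13)
and (4.14), `∫ Φ C_F = ∫ Φ_F C_O^{(ν)}`, the diagonal-pairing functional (3.9)
(`rsPairingFunctional ν`) of the pulled-back `Φ_F`, which is the limit of
`C_ν(ι_F^* f_Φ, T)/N(T)` given by Theorem 3.2. Since `rsPairingFunctional ν Φ'` only evaluates
`Φ'` on the hyperplane `∑ ξ_j = 0` (the arguments `∑ v_t e_{i(t)j(t)}` lie there), where `Φ'` is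
determined by `f_{Φ'}` (Fourier inversion), it takes the same value on *every* admissible `Φ'`
with `f_{Φ'} = ι_F^* f_Φ`; the fact is therefore stated for an arbitrary family of such
representatives `Φ'_F` (as produced by `RudnickSarnak.exists_rsPhiTest_comp_surjective`),
indexed by the set partitions `Q` of `Fin (k+1)` with block maps
`blockIdxSucc Q : Fin (k+1) → Fin ν(Q)`, `ν(Q) = #Q.parts` (written `#Q.parts - 1 + 1`, as the
level of `rsPhiTest` is a successor). Theorem 4.1 plus Parseval
(`∫ Φ(u) Ŵ_n(u) du = ∫ f_Φ(x) W_n(x) δ(x̄) dx = rsLimit k f_Φ`, RS (1.5), p. 307: "In view of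
(4.15), (4.16), and the definition of the GUE determinant `W_n(u)` (1.5), Theorem 1.2 follows
from Theorem 4.1") then reads: `∑_Q μ(O, Q) · rsPairingFunctional ν(Q) Φ'_Q = rsLimit k f_Φ`.

## Contents

* `RudnickSarnak.card_parts_pos`, `RudnickSarnak.card_parts_eq`, `RudnickSarnak.blockIdxSucc`,
  `RudnickSarnak.blockIdxSucc_surjective`.
* `rudnick_sarnak_thm41` (NAMED FACT, RS Thm. 4.1 with (4.13)–(4.16) and (1.5)).
* `rudnick_sarnak_sieving_of_thm41 : rudnick_sarnak_thm41 → rudnick_sarnak_sieving` (PROVED).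
* `rudnick_sarnak_of_thm41 : rudnick_sarnak_unrestricted → rudnick_sarnak_thm41 → rudnick_sarnak`.

## References

* Z. Rudnick, P. Sarnak, Duke Math. J. 81 (1996), 269–322: (1.5), (3.9), Thm. 3.2, §4
  (4.5)–(4.16), Lemma 4.1, Thm. 4.1 (p. 307), Props. 4.1–4.3.
-/

noncomputable section

open Filter Topology Finset

namespace Literature.NumberTheory.LFunctions

namespace RudnickSarnak

variable {n : ℕ}

/-- A set partition of the nonempty set `{0, …, n}` has at least one block. [folklore] -/
theorem card_parts_pos (Q : Finpartition (univ : Finset (Fin (n + 1)))) : 0 < #Q.parts := by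
  rw [Finset.card_pos]
  exact Q.parts_nonempty (Finset.univ_nonempty.ne_empty)

/-- `ν(Q) = (ν(Q) − 1) + 1` for the number of blocks of a set partition of `{0, …, n}`.
[folklore] -/
theorem card_parts_eq (Q : Finpartition (univ : Finset (Fin (n + 1)))) :
    #Q.parts = #Q.parts - 1 + 1 :=
  (Nat.succ_pred_eq_of_pos (card_parts_pos Q)).symm

/-- The block-index map of a set partition `Q` of `{0, …, n}` (`blockIdx`, RS's `ι_F`), read in
`Fin (ν(Q) − 1 + 1)` so that the level of the pulled-back test function is a successor, as
`rsPhiTest`/`IsRSAdmissiblePhi` require. [cite: RudnickSarnak1996, (4.5)] -/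
def blockIdxSucc (Q : Finpartition (univ : Finset (Fin (n + 1)))) (a : Fin (n + 1)) :
    Fin (#Q.parts - 1 + 1) :=
  Fin.cast (card_parts_eq Q) (blockIdx Q a)

/-- The block-index map is surjective. [folklore] -/
theorem blockIdxSucc_surjective (Q : Finpartition (univ : Finset (Fin (n + 1)))) :
    Function.Surjective (blockIdxSucc Q) :=
  (finCongr (card_parts_eq Q)).surjective.comp (blockIdx_surjective Q)

end RudnickSarnak

open RudnickSarnak

/-! ## Theorem 4.1 as a named fact -/

/-- **rh.S32** NAMED FACT (Rudnick–Sarnak, Duke Math. J. 81 (1996), **Theorem 4.1** with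
(4.13)–(4.16) and (1.5), for `L = ζ`). As printed: "THEOREM 4.1. Let
`W_n(x) = det(K(x_i − x_j))`, `K(x) = sin πx/πx`. Then, for `∑ |u_j| < 2`, the Fourier transform
`Ŵ_n(u)` is equal to `R_O(u)` in (4.16)", where `R_O(u) = ∑_F μ(O, F) C_F(u)` ((4.16)) is the
density of the sieved limit `R_O(f, T) = N(T) ∫ Φ(u) R_O(u) du + o(N(T))` ((4.15)), the
`C_F(u)` are the distributions of Lemma 4.1 / (4.13), and "in view of (4.15), (4.16), and the
definition of the GUE determinant `W_n(u)` (1.5), Theorem 1.2 follows from Theorem 4.1" (p. 307)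
— i.e. `∫ Φ(u) R_O(u) du = ∫ Φ(u) Ŵ_n(u) du = ∫ f_Φ(x) W_n(x) δ(x̄) dx` (Parseval). Encoded as the
resulting identity of limits, paired with an admissible `Φ` (see the module docstring): for
`n = k + 1 ≥ 2`, `Φ` admissible with `f_Φ` satisfying TF 1–3, and any admissible representatives
`Φ'_Q` of the pulled-back test functions `ι_Q^* f_Φ = f_Φ ∘ (· ∘ blockIdxSucc Q)` over the set
partitions `Q` of `Fin (k+1)` (by (4.14) and Lemma 4.1, `∫ Φ C_Q = rsPairingFunctional ν(Q) Φ'_Q`,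
independently of the representative),
`∑_Q μ(O, Q) · rsPairingFunctional ν(Q) Φ'_Q = rsLimit k f_Φ` with `μ(O, Q) = partitionMoebius Q`
(RS (4.3)) and `rsLimit k f_Φ = ∫ f_Φ(x) W_{k+1}(x) δ(x̄) dx`. Its printed proof is Props. 4.1–4.3
(pp. 307–316: the marking/pairing combinatorics, Spitzer's identity, and the expansion (4.27) of
the determinant). Users take `(h : rudnick_sarnak_thm41)`.
[cite: RudnickSarnak1996, Thm 4.1 with (4.13)–(4.16), (1.5)] -/
def rudnick_sarnak_thm41 : Prop :=
  ∀ {k : ℕ}, 1 ≤ k → ∀ {Φ : (Fin (k + 1) → ℝ) → ℂ}, IsRSAdmissiblePhi k Φ →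
    IsRSTestFunction k (rsPhiTest Φ) →
    ∀ Φ' : (Q : Finpartition (univ : Finset (Fin (k + 1)))) → (Fin (#Q.parts - 1 + 1) → ℝ) → ℂ,
      (∀ Q, IsRSAdmissiblePhi (#Q.parts - 1) (Φ' Q)) →
      (∀ Q, rsPhiTest (Φ' Q) = fun z ↦ rsPhiTest Φ (fun a ↦ z (blockIdxSucc Q a))) →
      ∑ Q, (partitionMoebius Q : ℂ) * rsPairingFunctional (#Q.parts - 1 + 1) (Φ' Q) =
        rsLimit k (rsPhiTest Φ)

/-! ## The sieving step from Theorem 4.1 -/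

/-- **RS §4 for `ζ` from Theorem 4.1.** The named fact `rudnick_sarnak_sieving`
(`RH → RSUnrestrictedLimits → RSRestrictedLimits`) follows from `rudnick_sarnak_thm41`: write
`R_n(f_Φ, T) = levelCorrelationSum/N(T)` as `∑_Q μ(O, Q) C_{ν(Q)}(ι_Q^* f_Φ, T)/N(T)`
(`levelCorrelationSum_eq_sum_partitionMoebius`), represent each `ι_Q^* f_Φ` as `f_{Φ'_Q}` with
`Φ'_Q` admissible (`exists_rsPhiTest_comp_surjective`), apply Theorem 3.2
(`RSUnrestrictedLimits`) to each of the finitely many `Φ'_Q`, and identify the limit by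
Theorem 4.1 (`rudnick_sarnak_thm41`). (RH is not used beyond being a hypothesis of the fact.)
[cite: RudnickSarnak1996, §4 (4.9), (4.14)–(4.16), Thm 4.1] -/
theorem rudnick_sarnak_sieving_of_thm41 (h41 : rudnick_sarnak_thm41) : rudnick_sarnak_sieving := by
  intro _ hU k hk Φ hΦ hTF
  -- admissible representatives of the pulled-back test functions
  have hrep : ∀ Q : Finpartition (univ : Finset (Fin (k + 1))),
      ∃ Φ' : (Fin (#Q.parts - 1 + 1) → ℝ) → ℂ, IsRSAdmissiblePhi (#Q.parts - 1) Φ' ∧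
        rsPhiTest Φ' = fun z ↦ rsPhiTest Φ (z ∘ blockIdxSucc Q) :=
    fun Q ↦ exists_rsPhiTest_comp_surjective hΦ hTF.schwartz_slice (blockIdxSucc_surjective Q)
  choose Φ' hΦ'adm hΦ'eq using hrep
  have hlimit : ∑ Q, (partitionMoebius Q : ℂ) * rsPairingFunctional (#Q.parts - 1 + 1) (Φ' Q) =
      rsLimit k (rsPhiTest Φ) :=
    h41 hk hΦ hTF Φ' hΦ'adm fun Q ↦ hΦ'eq Q
  -- the correlation function as the sieved combination of unrestricted sums of the `f_{Φ'_Q}`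
  have hfun : (fun T : ℝ ↦ levelCorrelationSum (k + 1) (rsPhiTest Φ) (zetaZeroCount T) /
      zetaZeroCount T) = fun T ↦ ∑ Q, (partitionMoebius Q : ℂ) *
        (unrestrictedLevelSum (#Q.parts - 1 + 1) (rsPhiTest (Φ' Q)) (zetaZeroCount T) /
          zetaZeroCount T) := by
    funext T
    rw [levelCorrelationSum_eq_sum_partitionMoebius, Finset.sum_div]
    refine Finset.sum_congr rfl fun Q _ ↦ ?_
    rw [mul_div_assoc, hΦ'eq Q, unrestrictedLevelSum_comp_cast (card_parts_eq Q)]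
    congr 3
  rw [hfun, ← hlimit]
  refine tendsto_finsetSum _ fun Q _ ↦ ?_
  exact (hU (hΦ'adm Q)).const_mul _

/-- **Theorem 1.2 for `ζ` from RS Thm. 3.2 and RS Thm. 4.1.** Combining `rudnick_sarnak_of_sieving`
(`RudnickSarnakProofs.lean`) with `rudnick_sarnak_sieving_of_thm41`: the named fact
`rudnick_sarnak` follows from `rudnick_sarnak_unrestricted` (RS Theorem 3.2 for `m = 1`) and
`rudnick_sarnak_thm41` (RS Theorem 4.1 with (4.13)–(4.16), (1.5)).
[cite: RudnickSarnak1996, Thm 1.2, Thm 3.2, Thm 4.1] -/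
theorem rudnick_sarnak_of_thm41 (h₁ : rudnick_sarnak_unrestricted) (h₂ : rudnick_sarnak_thm41) :
    rudnick_sarnak :=
  rudnick_sarnak_of_sieving h₁ (rudnick_sarnak_sieving_of_thm41 h₂)

end Literature.NumberTheory.LFunctions

end
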